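/-
Origin: expansion seat `prover-pub-hodgecm-mc-binder-2-g13-0`, handover #72 2026-08-20T08:07Z md5 dd5e736e51d0 (324 l.; 13 s; imports #68 `DensePlaceRange`, theta-3 `Model/ArchLineCenterChar` (RUN 40; `follandFock_one_ne_zero`); (V-val) OFF ι₁: §1 `uOfLetter b x ∈ U(σ_{w(b)} diag d_V)(ℂ)` (V-half of the inverse pair frame of `κ (x,1)`), **`letterSectionAt_kV`** (`letterSectionAt b (x,1) = (archSingle (w b) (uOfLetter b x), 1)`, tree `archPairSection_apply`); §2 `kVLetters_mulSingle`, `letterSection_kVLetters_mulSingle`, **`kPair_lettInv_mulSingle`** (`kPair (lettInv (mulSingle b x)) = ((archSingle (w b) u)^𝔸, 1)`), `dVIota_mulSingle_of_ne` (= 1), `archFrameConj_lettInvArch_mulSingle`, **`archProj_lettInv_mulSingle`** (b ≠ v₁ ⇒ `π (lettInv (mulSingle b x)) = 1`: the w(ι₁)-matrix of `frameG⁻¹ k frameG` is 1 by #62 `coe_archAt_cmPlaceOver_archFrameConj` + tree `archAt_archSingle_of_ne`, `embTwist` injective), **`archKappa_lettInv_mulSingle`** (= 1); §3 `cmArchWeilRep_archSingle_uOfLetter_follandFock_one`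 (vacuum pinning of `pinLetterChar` on the one-place element, #42 `cmArchWeilRep_letterSection_follandFock_one`), **`pairVacExponent V S hGR hW : {v real} → ℤ`** (ONE `Classical.choose` of discharge-4 `exists_exponent_of_signs` at the pin's sign facts, M = 2 via `signs_fin_two`), `cmArchWeilRep_archSingle_follandFock_one` (its spec on `follandFock cmBigFrame 1`), **`pinLetterChar_kVLetters_mulSingle`**: `pinLetterChar (kVLetters (mulSingle b x)) = det(uOfLetter b x)^{pairVacExponent b}` (b ≠ v₁) — THE CLOSED FORM of the letter character off ι₁; §4 **`hκ_lettInv_mulSingle_of_type`**: at E's `η = cmDetTwistChar (charOfUnitaryLineChar χV) (charOfUnitaryLineChar χW)` with `HasArchType χV nV` and the (S-norm) normalisation `nV (cmPlaceOver b).1 = −pairVacExponent b`, the (V-val) identity `η(kPair k)·pinLetterChar(kVLetters (lett k))·dVIota(lett k v₁) = archKappa k` HOLDS at `k = lettInv (mulSingle b x)` for every b ≠ v₁ (K-1 `coe_cmDetTwistChar_archSingle_one`: `η((archSingle u)^𝔸,1) = det(u)^{nV(w b)}`; exponents cancel); NAME LIST `HodgeCM.Model.HypCensus.hκ_lettInv_mulSingle_of_type`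 · `….pinLetterChar_kVLetters_mulSingle` · `….archKappa_lettInv_mulSingle` · `….pairVacExponent`) (`HOME/mc/pub-hodgecm-mc-binder-2/g13/pkg/HodgeCM/Model/HypCensus/KappaPlace.lean`, md5 dd5e736e51d0, 324 lines);
landed by the gen-17 packager (p-g17) in gate run 45 as `HodgeCM/Model/HypCensus/KappaPlace.lean` (verbatim).
-/
/-
Copyright (c) 2026. All rights reserved.
Released under Apache 2.0 license as described in the file LICENSE.
-/
import Summits.HodgeConjecture.HodgeCM.Model.HypCensus.DensePlaceRange
import Summits.HodgeConjecture.HodgeCM.Model.ArchLineCenterChar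

/-!
# (V-val) off `ι₁`: the rows-18/19 identity `hκ` on the letters of a DEFINITE place, from the (S-norm) type normalisation

Binder-2 lineage, rows 18/19 (`hyp12`/`hyp34`).  After #71 the residual list of the census at the W pin of record is
{`hκ` ((V-val)), `homg`/`homg₃₄`}.  `hκ` is ONE identity on `K_∞ ≃* Π_w U(V⁺_w) × U(V⁻_w)` (#62 `lettEquiv`):

  `η(kPair k) · pinLetterChar (kVLetters (lett k)) · dVIota (lett k v₁) = archKappa k`.

This leaf evaluates all four factors on the letters of ONE real place `b ≠ v₁ = w(ι₁)` (there `V_b` is definite):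

* §1 `uOfLetter b x ∈ U(σ_{w(b)} diag d_V)(ℂ)` and `letterSectionAt_kV`: the letter section of the `K_V`-letter `(x, 1)` at `b` is the
  one-place element `(archSingle (w b) (uOfLetter b x), 1)` (tree `archPairSection_apply`);
* §2 at the pin: `kVLetters_mulSingle`, `letterSection_kVLetters_mulSingle`, `kPair_lettInv_mulSingle`
  (`kPair (lettInv (mulSingle b x)) = ((archSingle (w b) u)^𝔸, 1)`), `dVIota_lettInv_mulSingle` (`= 1`),
  **`archKappa_lettInv_mulSingle`** (`= 1`: the `w(ι₁)`-matrix of `frameG⁻¹ k frameG` is `1`, so `π k = 1`; #62 `coe_archAt_cmPlaceOver_archFrameConj`);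
* §3 `pinLetterChar_kVLetters_mulSingle_smul_vacuum`: the letter character is PINNED by the vacuum `follandFock 𝔢 1` on that element;
  with discharge-4's raw exponent `pairVacExponent` (`DefiniteVacuumExponent.exists_exponent_of_signs` at the pin's sign facts)
  **`pinLetterChar_kVLetters_mulSingle`**: `pinLetterChar (kVLetters (mulSingle b x)) = det(u)^{a b}`;
* §4 **`hκ_mulSingle_of_type`**: for E's `η = cmDetTwistChar (χ_V∘det_V) (χ_W∘det_W)` with `χ_V` of archimedean type `n_V` and the
  (S-norm) normalisation `n_V (w(b)) = −a b` ([GelbartRogawski1991 §3.1 Remark p. 457]: no local component of a compatible splitting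
  is pinned — one normalises), the identity `hκ` HOLDS at every `k = lettInv (mulSingle b x)`, `b ≠ v₁`
  (K-1 `coe_cmDetTwistChar_archSingle_one`: `η((archSingle u)^𝔸, 1) = det(u)^{n_V(w b)}`).

So (V-val) is REDUCED to its `ι₁`-letters (the sibling leaf `KappaLetters` assembles: `hκ ⟸ hκ₁ + the type normalisation off ι₁`).
[KonnoKonno2007 §3.1 (3.1); Folland1989 Prop. (4.39); GelbartRogawski1991 §3.1 Prop. 3.1.1, Remark p. 457; folklore]
Nothing here is a claim of PerL/QW8.
-/

noncomputable section

open NumberField NumberField.InfinitePlace IsDedekindDomain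
open scoped Matrix Classical TensorProduct
open MvPolynomial
open Literature.NumberTheory.Automorphic Literature.NumberTheory.Automorphic.UnitaryGroup Literature.NumberTheory.Weil1964
open Literature.RepresentationTheory.KonnoKonno2007 Literature.RepresentationTheory.KonnoKonno2007.RealDualPair
open Literature.NumberTheory.GelbartRogawski1991 Literature.NumberTheory.GelbartRogawski1991.UnitaryDualPair
open Literature.Analysis.SegalBargmann
open Literature.Geometry.ComplexHyperbolic.BallModel (U21 x₀ mat mat_injective)
open HodgeCM HodgeCM.Model HodgeCM.Adelic
open HodgeCM.Model.ArchSideTerm (follandFock_one_ne_zero)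

namespace HodgeCM.Model.HypCensus

/-! ## §1 The one-place element of a `K_V`-letter -/

section Datum

variable (L : Type) [Field L] [NumberField L] [IsCMField L] {N M : ℕ}
variable (dV : Fin N → L) (hdV : ∀ i, IsCMField.complexConj L (dV i) = dV i) (hdV0 : ∀ i, dV i ≠ 0)
variable (dW : Fin M → L) (hdW : ∀ i, IsCMField.complexConj L (dW i) = dW i) (hdW0 : ∀ i, dW i ≠ 0)
variable (ι₁ : L →+* ℂ)

/-- **the local unitary element of a `K_V`-letter** `x = (A, D)` at the real place `v`: the `V`-half of the inverse pair frame of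
`κ (x, 1) = (diag(A, D), 1)` — an element of `U(σ_{w(v)} diag d_V)(ℂ)`. -/
def uOfLetter (v : {v : InfinitePlace ↥(maximalRealSubfield L) // v.IsReal})
    (x : Matrix.unitaryGroup (PosIdx (cmXV L dV hdV ι₁ v)) ℂ × Matrix.unitaryGroup (NegIdx (cmXV L dV hdV ι₁ v)) ℂ) :
    archLocal L N (Matrix.diagonal dV) (cmPlaceOver L v) :=
  ((archPairFrameEquiv L (IsCMField.complexConj L) N M (IsCMField.complexConj_ne_one L) (cmPlaceOver L) (cmPlaceOver_smul L)
      (cmPlaceOver_comap L) (cmRealVec L dV hdV) (cmRealVec L dW hdW) (realDiagonal_map L dV hdV).symm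
      (realDiagonal_map L dW hdW).symm (cmEpsV L dV hdV ι₁) (cmEpsW L dV dW hdW ι₁) (cmDV_ne_zero L dV hdV hdV0 ι₁)
      (cmDW_ne_zero L dV dW hdW hdW0 ι₁) (cmSignConv_ne_zero L dV ι₁) (cmCW_ne_zero L dV ι₁) (cm_htV L dV hdV hdV0 ι₁)
      (cm_htW L dV dW hdW hdW0 ι₁) v).symm
    (κ (PosIdx (cmXV L dV hdV ι₁ v)) (NegIdx (cmXV L dV hdV ι₁ v)) (PosIdx (cmXW L dV dW hdW ι₁ v)) (NegIdx (cmXW L dV dW hdW ι₁ v))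
      (x, 1))).1

/-- **the letter section of a `K_V`-letter at `v` is the one-place element `(archSingle (w v) u, 1)`.** -/
theorem letterSectionAt_kV (v : {v : InfinitePlace ↥(maximalRealSubfield L) // v.IsReal})
    (x : Matrix.unitaryGroup (PosIdx (cmXV L dV hdV ι₁ v)) ℂ × Matrix.unitaryGroup (NegIdx (cmXV L dV hdV ι₁ v)) ℂ) :
    letterSectionAt L dV hdV hdV0 dW hdW hdW0 ι₁ v (x, 1) =
      (archSingle (↥(maximalRealSubfield L)) L (IsCMField.complexConj L) N (Matrix.diagonal dV)
          (IsCMField.complexConj_ne_one L) (UnitaryGroup.complexConj_smul_infinitePlace L) (cmPlaceOver L v) (uOfLetter L dV hdV hdV0 dW hdW hdW0 ι₁ v x),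
        1) := by
  rw [letterSectionAt_apply, archPairSection_apply, archPairSingle_apply]
  refine Prod.ext rfl ?_
  dsimp only
  rw [← map_one (archSingle (↥(maximalRealSubfield L)) L (IsCMField.complexConj L) M (Matrix.diagonal dW)
    (IsCMField.complexConj_ne_one L) (UnitaryGroup.complexConj_smul_infinitePlace L) (cmPlaceOver L v))]
  congr 1
  set E := archPairFrameEquiv L (IsCMField.complexConj L) N M (IsCMField.complexConj_ne_one L) (cmPlaceOver L) (cmPlaceOver_smul L)
      (cmPlaceOver_comap L) (cmRealVec L dV hdV) (cmRealVec L dW hdW) (realDiagonal_map L dV hdV).symm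
      (realDiagonal_map L dW hdW).symm (cmEpsV L dV hdV ι₁) (cmEpsW L dV dW hdW ι₁) (cmDV_ne_zero L dV hdV hdV0 ι₁)
      (cmDW_ne_zero L dV dW hdW hdW0 ι₁) (cmSignConv_ne_zero L dV ι₁) (cmCW_ne_zero L dV ι₁) (cm_htV L dV hdV hdV0 ι₁)
      (cm_htW L dV dW hdW hdW0 ι₁) v with hE
  have h2 : (κ (PosIdx (cmXV L dV hdV ι₁ v)) (NegIdx (cmXV L dV hdV ι₁ v)) (PosIdx (cmXW L dV dW hdW ι₁ v)) (NegIdx (cmXW L dV dW hdW ι₁ v))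
      (x, 1)).2 = 1 := map_one (UForm.kV _ _)
  calc (E.symm (κ _ _ _ _ (x, 1))).2 = (E.symm (1, (κ _ _ _ _ (x, 1)).2)).2 := by rw [hE]; rfl
    _ = (E.symm 1).2 := by rw [h2]; rfl
    _ = 1 := by rw [map_one]; rfl

end Datum

/-! ## §2 At the pin: the four factors of (V-val) on the letters of one place -/

section Pin

variable {L : CMField} {ι₁ : L →+* ℂ} (V : HermSpace3 L ι₁) (S : StubTree.SeesawDatum L)

/-- the full letter family of a single-place `K_V`-letter family is the single-place family of the letter `(x, 1)`. -/
theorem kVLetters_mulSingle (b : {v : InfinitePlace ↥(maximalRealSubfield L) // v.IsReal})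
    (x : Matrix.unitaryGroup (PosIdx (cmXV (L : Type) (frameD V) (frameD_real V) ι₁ b)) ℂ ×
      Matrix.unitaryGroup (NegIdx (cmXV (L : Type) (frameD V) (frameD_real V) ι₁ b)) ℂ) :
    kVLetters V S (Pi.mulSingle b x) = Pi.mulSingle b (x, 1) := by
  funext w
  dsimp only [kVLetters]
  by_cases hw : w = b
  · subst hw
    rw [Pi.mulSingle_eq_same, Pi.mulSingle_eq_same]
    rfl
  · rw [Pi.mulSingle_eq_of_ne hw, Pi.mulSingle_eq_of_ne hw]
    rfl

/-- **the letter section of a single-place `K_V`-letter family at the pin.** -/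
theorem letterSection_kVLetters_mulSingle (b : {v : InfinitePlace ↥(maximalRealSubfield L) // v.IsReal})
    (x : Matrix.unitaryGroup (PosIdx (cmXV (L : Type) (frameD V) (frameD_real V) ι₁ b)) ℂ ×
      Matrix.unitaryGroup (NegIdx (cmXV (L : Type) (frameD V) (frameD_real V) ι₁ b)) ℂ) :
    letterSection (L : Type) (frameD V) (frameD_real V) (frameD_ne V) (dW S) (dW_real S) (dW_ne S) ι₁ (kVLetters V S (Pi.mulSingle b x)) =
      (archSingle (↥(maximalRealSubfield L)) (L : Type) (IsCMField.complexConj L) 3 (Matrix.diagonal (frameD V))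
          (IsCMField.complexConj_ne_one (L : Type)) (UnitaryGroup.complexConj_smul_infinitePlace (L : Type)) (cmPlaceOver (L : Type) b)
          (uOfLetter (L : Type) (frameD V) (frameD_real V) (frameD_ne V) (dW S) (dW_real S) (dW_ne S) ι₁ b x),
        1) := by
  rw [kVLetters_mulSingle, letterSection_mulSingle, letterSectionAt_kV]

/-- **`kPair` of the inverse-lettered single-place family is the adelic one-place element `((archSingle (w b) u)^𝔸, 1)`.** -/
theorem kPair_lettInv_mulSingle (b : {v : InfinitePlace ↥(maximalRealSubfield L) // v.IsReal})
    (x : Matrix.unitaryGroup (PosIdx (cmXV (L : Type) (frameD V) (frameD_real V) ι₁ b)) ℂ ×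
      Matrix.unitaryGroup (NegIdx (cmXV (L : Type) (frameD V) (frameD_real V) ι₁ b)) ℂ) :
    kPair V S ι₁ V.sylvesterFrame (sylvesterFrame_formCongr V) (lettInv V S (Pi.mulSingle b x)) =
      (archToAdelic (↥(maximalRealSubfield L)) (L : Type) (IsCMField.complexConj L) 3 (Matrix.diagonal (frameD V))
          (archSingle (↥(maximalRealSubfield L)) (L : Type) (IsCMField.complexConj L) 3 (Matrix.diagonal (frameD V))
            (IsCMField.complexConj_ne_one (L : Type)) (UnitaryGroup.complexConj_smul_infinitePlace (L : Type)) (cmPlaceOver (L : Type) b)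
            (uOfLetter (L : Type) (frameD V) (frameD_real V) (frameD_ne V) (dW S) (dW_real S) (dW_ne S) ι₁ b x)),
        1) := by
  have h1 : archFrameConj (L : Type) 3 V.Hm (frameG V) (frameD V) (frame_congr V) (lettInvArch V S (Pi.mulSingle b x)) = _ :=
    (archFrameConj_lettInvArch V S _).trans (congrArg Prod.fst (letterSection_kVLetters_mulSingle V S b x))
  change archProdHom (↥(maximalRealSubfield L)) (L : Type) (IsCMField.complexConj L) 3 2 (Matrix.diagonal (frameD V))
      (Matrix.diagonal (dW S)) (archFrameConj (L : Type) 3 V.Hm (frameG V) (frameD V) (frame_congr V) (lettInvArch V S (Pi.mulSingle b x)), 1) = _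
  rw [h1]
  exact Prod.ext rfl (map_one (archToAdelic (↥(maximalRealSubfield L)) (L : Type) (IsCMField.complexConj L) 2 (Matrix.diagonal (dW S))))

/-- the `ι₁` scalar of a single-place family off `ι₁` is `1`. -/
theorem dVIota_mulSingle_of_ne (b : {v : InfinitePlace ↥(maximalRealSubfield L) // v.IsReal}) (hb : b ≠ cmPlace (L : Type) ι₁)
    (x : Matrix.unitaryGroup (PosIdx (cmXV (L : Type) (frameD V) (frameD_real V) ι₁ b)) ℂ ×
      Matrix.unitaryGroup (NegIdx (cmXV (L : Type) (frameD V) (frameD_real V) ι₁ b)) ℂ) :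
    dVIota V S ((Pi.mulSingle b x : VLetterFam V) (cmPlace (L : Type) ι₁)) = 1 := by
  rw [Pi.mulSingle_eq_of_ne (Ne.symm hb)]
  exact dVIota_one V S

/-- the archimedean frame conjugate of the inverse-lettered single-place family IS the one-place element. -/
theorem archFrameConj_lettInvArch_mulSingle (b : {v : InfinitePlace ↥(maximalRealSubfield L) // v.IsReal})
    (x : Matrix.unitaryGroup (PosIdx (cmXV (L : Type) (frameD V) (frameD_real V) ι₁ b)) ℂ ×
      Matrix.unitaryGroup (NegIdx (cmXV (L : Type) (frameD V) (frameD_real V) ι₁ b)) ℂ) :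
    archFrameConj (L : Type) 3 V.Hm (frameG V) (frameD V) (frame_congr V) (lettInvArch V S (Pi.mulSingle b x)) =
      archSingle (↥(maximalRealSubfield L)) (L : Type) (IsCMField.complexConj L) 3 (Matrix.diagonal (frameD V))
        (IsCMField.complexConj_ne_one (L : Type)) (UnitaryGroup.complexConj_smul_infinitePlace (L : Type)) (cmPlaceOver (L : Type) b)
        (uOfLetter (L : Type) (frameD V) (frameD_real V) (frameD_ne V) (dW S) (dW_real S) (dW_ne S) ι₁ b x) :=
  (archFrameConj_lettInvArch V S _).trans (congrArg Prod.fst (letterSection_kVLetters_mulSingle V S b x))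

/-- **the ball projection of the inverse-lettered single-place family off `ι₁` is trivial**: its `w(ι₁)`-matrix is `1`
(#62 `coe_archAt_cmPlaceOver_archFrameConj`, tree `archAt_archSingle_of_ne`). -/
theorem archProj_lettInv_mulSingle (b : {v : InfinitePlace ↥(maximalRealSubfield L) // v.IsReal}) (hb : b ≠ cmPlace (L : Type) ι₁)
    (x : Matrix.unitaryGroup (PosIdx (cmXV (L : Type) (frameD V) (frameD_real V) ι₁ b)) ℂ ×
      Matrix.unitaryGroup (NegIdx (cmXV (L : Type) (frameD V) (frameD_real V) ι₁ b)) ℂ) :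
    archProjU21EmbCM (L : Type) V.Hm ι₁ V.sylvesterFrame (sylvesterFrame_formCongr V)
        ((lettInv V S (Pi.mulSingle b x) : ↥(KInfty V)) :
          UnitaryGroup.arch (↥(maximalRealSubfield L)) (L : Type) (IsCMField.complexConj L) 3 V.Hm) = 1 := by
  have hne : cmPlaceOver (L : Type) (cmPlace (L : Type) ι₁) ≠ cmPlaceOver (L : Type) b :=
    fun h => hb (cmPlaceOver_injective (L : Type) h).symm
  have hk1 : archAt (↥(maximalRealSubfield L)) (L : Type) (IsCMField.complexConj L) 3 (Matrix.diagonal (frameD V))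
      (cmPlaceOver (L : Type) (cmPlace (L : Type) ι₁)) (cmPlaceOver_smul (L : Type) _) (IsCMField.complexConj_ne_one (L : Type))
      (archFrameConj (L : Type) 3 V.Hm (frameG V) (frameD V) (frame_congr V) (lettInvArch V S (Pi.mulSingle b x))) = 1 := by
    rw [archFrameConj_lettInvArch_mulSingle]
    exact archAt_archSingle_of_ne (↥(maximalRealSubfield L)) (L : Type) (IsCMField.complexConj L) 3 (Matrix.diagonal (frameD V))
      (IsCMField.complexConj_ne_one (L : Type)) (UnitaryGroup.complexConj_smul_infinitePlace (L : Type)) (cmPlaceOver (L : Type) b) hne _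
  apply mat_injective
  rw [Literature.Geometry.ComplexHyperbolic.BallModel.mat_one]
  ext i j
  have h := coe_archAt_cmPlaceOver_archFrameConj V (lettInvArch V S (Pi.mulSingle b x)) (V.rationalFramePerm i) (V.rationalFramePerm j)
  rw [coe_lettInv]
  rw [hk1, Equiv.symm_apply_apply, Equiv.symm_apply_apply, OneMemClass.coe_one, Units.val_one, Matrix.one_apply] at h
  simp only [EmbeddingLike.apply_eq_iff_eq] at h
  have hs := sylvesterScale_coe_ne_zero V
  -- solve for the twisted entry
  set E := embTwist (L : Type) ι₁ (mat (archProjU21EmbCM (L : Type) V.Hm ι₁ V.sylvesterFrame (sylvesterFrame_formCongr V)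
      (lettInvArch V S (Pi.mulSingle b x))) i j) with hE
  have h' : E = (((V.sylvesterScale i : ℝ) : ℂ))⁻¹ * (if i = j then 1 else 0) * ((V.sylvesterScale j : ℝ) : ℂ) := by
    rw [h, show (((V.sylvesterScale i : ℝ) : ℂ))⁻¹ * (((V.sylvesterScale i : ℝ) : ℂ) * E * (((V.sylvesterScale j : ℝ) : ℂ))⁻¹) *
        ((V.sylvesterScale j : ℝ) : ℂ) =
      ((((V.sylvesterScale i : ℝ) : ℂ))⁻¹ * ((V.sylvesterScale i : ℝ) : ℂ)) * E *
        ((((V.sylvesterScale j : ℝ) : ℂ))⁻¹ * ((V.sylvesterScale j : ℝ) : ℂ)) by ring,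
      inv_mul_cancel₀ (hs i), inv_mul_cancel₀ (hs j), one_mul, mul_one]
  rw [Matrix.one_apply]
  by_cases hij : i = j
  · subst hij
    rw [if_pos rfl, mul_one, inv_mul_cancel₀ (hs i)] at h'
    rw [if_pos rfl]
    exact (embTwist (L : Type) ι₁).injective (h'.trans (map_one _).symm)
  · rw [if_neg hij, mul_zero, zero_mul] at h'
    rw [if_neg hij]
    exact (embTwist (L : Type) ι₁).injective (h'.trans (map_zero _).symm)

/-- **`archKappa` of the inverse-lettered single-place family off `ι₁` is `1`.** -/
theorem archKappa_lettInv_mulSingle (b : {v : InfinitePlace ↥(maximalRealSubfield L) // v.IsReal}) (hb : b ≠ cmPlace (L : Type) ι₁)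
    (x : Matrix.unitaryGroup (PosIdx (cmXV (L : Type) (frameD V) (frameD_real V) ι₁ b)) ℂ ×
      Matrix.unitaryGroup (NegIdx (cmXV (L : Type) (frameD V) (frameD_real V) ι₁ b)) ℂ) :
    UnitaryGroup.archKappa (L : Type) V.Hm ι₁ V.sylvesterFrame (sylvesterFrame_formCongr V) (lettInv V S (Pi.mulSingle b x)) = 1 :=
  UnitaryGroup.archKappa_eq_one_of_mem_ker (L : Type) V.Hm ι₁ V.sylvesterFrame (sylvesterFrame_formCongr V) _
    ((MonoidHom.mem_ker).mpr (archProj_lettInv_mulSingle V S b hb x))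

end Pin

/-! ## §3 The letter character on a place letter: pinned by the vacuum, read off discharge-4's exponent -/

section Char

variable {L : CMField} {ι₁ : L →+* ℂ} (V : HermSpace3 L ι₁) (S : StubTree.SeesawDatum L)
variable
  (hGR : (cmSplittingDatum (L : Type) finProdFinEquiv (frameD V) (frameD_real V) (frameD_ne V) (dW S) (dW_real S) (dW_ne S)).CompatibleSplitting)
  (hW : (∀ j, 0 < (ι₁ ((dW S) j)).re) ∨ ∀ j, (ι₁ ((dW S) j)).re < 0)

/-- **the letter character of a place letter is PINNED BY THE VACUUM on the one-place element.** -/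
theorem cmArchWeilRep_archSingle_uOfLetter_follandFock_one (b : {v : InfinitePlace ↥(maximalRealSubfield L) // v.IsReal})
    (x : Matrix.unitaryGroup (PosIdx (cmXV (L : Type) (frameD V) (frameD_real V) ι₁ b)) ℂ ×
      Matrix.unitaryGroup (NegIdx (cmXV (L : Type) (frameD V) (frameD_real V) ι₁ b)) ℂ) :
    cmArchWeilRep (L : Type) finProdFinEquiv (frameD V) (frameD_real V) (frameD_ne V) (dW S) (dW_real S) (dW_ne S) hGR
        (archSingle (↥(maximalRealSubfield L)) (L : Type) (IsCMField.complexConj L) 3 (Matrix.diagonal (frameD V))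
            (IsCMField.complexConj_ne_one (L : Type)) (UnitaryGroup.complexConj_smul_infinitePlace (L : Type)) (cmPlaceOver (L : Type) b)
            (uOfLetter (L : Type) (frameD V) (frameD_real V) (frameD_ne V) (dW S) (dW_real S) (dW_ne S) ι₁ b x),
          1)
        (follandFock (cmBigFrame (L : Type) finProdFinEquiv (frameD V) (frameD_real V) (frameD_ne V) (dW S) (dW_real S) (dW_ne S) ι₁) 1) =
      ((pinLetterChar V S hGR hW (kVLetters V S (Pi.mulSingle b x)) : Circle) : ℂ) •
        follandFock (cmBigFrame (L : Type) finProdFinEquiv (frameD V) (frameD_real V) (frameD_ne V) (dW S) (dW_real S) (dW_ne S) ι₁) 1 := by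
  rw [← letterSection_kVLetters_mulSingle]
  exact cmArchWeilRep_letterSection_follandFock_one (L : Type) (frameD V) (frameD_real V) (frameD_ne V) (dW S) (dW_real S) (dW_ne S) hGR ι₁
    (frameD_sign_ι₁' V) hW (frameD_sign_of_ne V)
    (fun τ' _ => signs_fin_two fun j => re_apply_ne_zero_of_complexConj_eq (L : Type) τ' (dW_real S j) (dW_ne S j)) _

/-- **the raw vacuum exponents of the pin's pair splitting at the definite places** (discharge-4 `exists_exponent_of_signs` at the pin's sign
facts; one `Classical.choose`, as #17's `placeVacExponents`). -/
def pairVacExponent : {v : InfinitePlace ↥(maximalRealSubfield L) // v.IsReal} → ℤ :=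
  (exists_exponent_of_signs (L : Type) finProdFinEquiv (frameD V) (frameD_real V) (frameD_ne V) (dW S) (dW_real S) (dW_ne S) hGR ι₁
    (frameD_sign_ι₁' V) hW (frameD_sign_of_ne V)
    (fun τ' _ => signs_fin_two fun j => re_apply_ne_zero_of_complexConj_eq (L : Type) τ' (dW_real S j) (dW_ne S j))).choose

/-- the defining property of `pairVacExponent` on the vacuum `follandFock 𝔢 1`. -/
theorem cmArchWeilRep_archSingle_follandFock_one (b : {v : InfinitePlace ↥(maximalRealSubfield L) // v.IsReal})
    (hb : b ≠ cmPlace (L : Type) ι₁) (u : archLocal (L : Type) 3 (Matrix.diagonal (frameD V)) (cmPlaceOver (L : Type) b)) :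
    cmArchWeilRep (L : Type) finProdFinEquiv (frameD V) (frameD_real V) (frameD_ne V) (dW S) (dW_real S) (dW_ne S) hGR
        (archSingle (↥(maximalRealSubfield L)) (L : Type) (IsCMField.complexConj L) 3 (Matrix.diagonal (frameD V))
            (IsCMField.complexConj_ne_one (L : Type)) (UnitaryGroup.complexConj_smul_infinitePlace (L : Type)) (cmPlaceOver (L : Type) b) u,
          1)
        (follandFock (cmBigFrame (L : Type) finProdFinEquiv (frameD V) (frameD_real V) (frameD_ne V) (dW S) (dW_real S) (dW_ne S) ι₁) 1) =
      (((u : archLocal (L : Type) 3 (Matrix.diagonal (frameD V)) (cmPlaceOver (L : Type) b)) : GL (Fin 3) ℂ) : Matrix (Fin 3) (Fin 3) ℂ).det ^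
          pairVacExponent V S hGR hW b •
        follandFock (cmBigFrame (L : Type) finProdFinEquiv (frameD V) (frameD_real V) (frameD_ne V) (dW S) (dW_real S) (dW_ne S) ι₁) 1 := by
  have hb' : b.1 ≠ (InfinitePlace.mk ι₁).comap (algebraMap (↥(maximalRealSubfield L)) (L : Type)) := fun h => hb (Subtype.ext h)
  exact (exists_exponent_of_signs (L : Type) finProdFinEquiv (frameD V) (frameD_real V) (frameD_ne V) (dW S) (dW_real S) (dW_ne S) hGR ι₁
    (frameD_sign_ι₁' V) hW (frameD_sign_of_ne V)
    (fun τ' _ => signs_fin_two fun j => re_apply_ne_zero_of_complexConj_eq (L : Type) τ' (dW_real S j) (dW_ne S j))).choose_spec b hb' u 1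
    (fun y hy => absurd hy (by rw [MvPolynomial.vars_one]; exact Finset.notMem_empty _)) _ (schwartzTransport_follandFock _ 1)

/-- **THE LETTER CHARACTER ON A PLACE LETTER, CLOSED FORM**: `pinLetterChar (kVLetters (mulSingle b x)) = det(u_x)^{a b}`, `b ≠ v₁`. -/
theorem pinLetterChar_kVLetters_mulSingle (b : {v : InfinitePlace ↥(maximalRealSubfield L) // v.IsReal}) (hb : b ≠ cmPlace (L : Type) ι₁)
    (x : Matrix.unitaryGroup (PosIdx (cmXV (L : Type) (frameD V) (frameD_real V) ι₁ b)) ℂ ×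
      Matrix.unitaryGroup (NegIdx (cmXV (L : Type) (frameD V) (frameD_real V) ι₁ b)) ℂ) :
    ((pinLetterChar V S hGR hW (kVLetters V S (Pi.mulSingle b x)) : Circle) : ℂ) =
      (((uOfLetter (L : Type) (frameD V) (frameD_real V) (frameD_ne V) (dW S) (dW_real S) (dW_ne S) ι₁ b x :
          archLocal (L : Type) 3 (Matrix.diagonal (frameD V)) (cmPlaceOver (L : Type) b)) : GL (Fin 3) ℂ) : Matrix (Fin 3) (Fin 3) ℂ).det ^
        pairVacExponent V S hGR hW b :=
  smul_left_injective ℂ (follandFock_one_ne_zero _)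
    ((cmArchWeilRep_archSingle_uOfLetter_follandFock_one V S hGR hW b x).symm.trans
      (cmArchWeilRep_archSingle_follandFock_one V S hGR hW b hb _))

end Char

/-! ## §4 (V-val) on the letters of a definite place, from the (S-norm) type normalisation -/

section Val

variable {L : CMField} {ι₁ : L →+* ℂ} (V : HermSpace3 L ι₁) (S : StubTree.SeesawDatum L)
variable
  (hGR : (cmSplittingDatum (L : Type) finProdFinEquiv (frameD V) (frameD_real V) (frameD_ne V) (dW S) (dW_real S) (dW_ne S)).CompatibleSplitting)
  (hW : (∀ j, 0 < (ι₁ ((dW S) j)).re) ∨ ∀ j, (ι₁ ((dW S) j)).re < 0)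
variable (χV χW : ContinuousMonoidHom
  (Literature.NumberTheory.Automorphic.relNormOneIdeles (↥(maximalRealSubfield L)) (L : Type) ⧸
    Literature.NumberTheory.Automorphic.relNormOneRat (↥(maximalRealSubfield L)) (L : Type)) Circle)
variable {nV : InfinitePlace (L : Type) → ℤ}

/-- **(V-val) ON THE LETTERS OF A DEFINITE PLACE.**  For E's `η = (χ_V ∘ det_V)·(χ_W ∘ det_W)` with `χ_V` of archimedean type `n_V`
normalised at the real place `b ≠ v₁` by `n_V (w(b)) = −a b` (`a = pairVacExponent`, the raw vacuum exponent of the chosen pair splitting),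
the rows-18/19 identity `η(kPair k) · pinLetterChar (kVLetters (lett k)) · dVIota (lett k v₁) = archKappa k` holds at every
`k = lettInv (mulSingle b x)` (read with `lett k = mulSingle b x`, #62 `lett_lettInv`). [GelbartRogawski1991 §3.1 Remark p. 457; KonnoKonno2007 §3.1 (3.1); Folland1989 Prop. (4.39)] -/
theorem hκ_lettInv_mulSingle_of_type (hnV : UnitaryLineChar.HasArchType (L : Type) χV nV)
    (b : {v : InfinitePlace ↥(maximalRealSubfield L) // v.IsReal}) (hb : b ≠ cmPlace (L : Type) ι₁)
    (hn : nV (cmPlaceOver (L : Type) b).1 = -pairVacExponent V S hGR hW b)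
    (x : Matrix.unitaryGroup (PosIdx (cmXV (L : Type) (frameD V) (frameD_real V) ι₁ b)) ℂ ×
      Matrix.unitaryGroup (NegIdx (cmXV (L : Type) (frameD V) (frameD_real V) ι₁ b)) ℂ) :
    ((cmDetTwistChar (L : Type) (frameD V) (frameD_ne V) (dW S) (dW_ne S) (charOfUnitaryLineChar (L : Type) χV)
          (charOfUnitaryLineChar (L : Type) χW)
          (kPair V S ι₁ V.sylvesterFrame (sylvesterFrame_formCongr V) (lettInv V S (Pi.mulSingle b x))) : ℂˣ) : ℂ) *
        ((pinLetterChar V S hGR hW (kVLetters V S (Pi.mulSingle b x)) : Circle) : ℂ) *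
        dVIota V S ((Pi.mulSingle b x : VLetterFam V) (cmPlace (L : Type) ι₁)) =
      ((UnitaryGroup.archKappa (L : Type) V.Hm ι₁ V.sylvesterFrame (sylvesterFrame_formCongr V) (lettInv V S (Pi.mulSingle b x)) : ℂˣ) :
        ℂ) := by
  have hη := coe_cmDetTwistChar_archSingle_one (L : Type) (frameD V) (frameD_ne V) (dW S) (dW_ne S) χV χW
    (cmPlaceOver (L : Type) b) hnV (uOfLetter (L : Type) (frameD V) (frameD_real V) (frameD_ne V) (dW S) (dW_real S) (dW_ne S) ι₁ b x)
  rw [kPair_lettInv_mulSingle]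
  erw [hη]
  rw [pinLetterChar_kVLetters_mulSingle V S hGR hW b hb, dVIota_mulSingle_of_ne V S b hb,
    archKappa_lettInv_mulSingle V S b hb, mul_one, Units.val_one,
    ← zpow_add₀ (det_coe_archLocal_ne_zero (L : Type) 3 (Matrix.diagonal (frameD V)) (cmPlaceOver (L : Type) b) _), hn, neg_add_cancel,
    zpow_zero]

end Val

end HodgeCM.Model.HypCensus

end
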